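import Summits.CriticalPhenomena.CardyFormulaZ2.Theses.CardyBondTriangular
import Summits.CriticalPhenomena.CardyFormulaZ2.Theorems.CardyBondTriangularSwitchingReductionFromSwitching
import HarnessLib

/-!
# Route CardyBondTriangular · crux `BondTriangularCardy` (stmt-CriticalPhenomena-4664), line `birth`:
# separating data from WEAK boundary values (reshape v3 of the line lead)

Bollobás–Riordan's separating data (`IsSeparatingData`, `SmirnovSeparatingData.lean`) ask, on each
open arc `Aᵢ`, for points `z_δ → z` with `fⁱ_δ(z_δ) → 0` AND `f^{i+1}_δ(z_δ) + f^{i+2}_δ(z_δ) → 1`.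
For SITE percolation the second clause is duality + colour symmetry (the yellow and blue
"four-arc-touch" probabilities of the same domain agree); for critical BOND percolation on `𝕋` in
the Chayes–Lei representation there is no colour symmetry of a fixed domain, and the clause is not
available from percolation estimates. It is however a CONSEQUENCE of the rest of the data plus a
one-point normalisation, by Smirnov's own argument for `Σᵢ hⁱ ≡ 1` (Bollobás–Riordan 2006, Ch. 7,
proof of Claim 24 p. 201: "by Morera `Σ gⁱ` is analytic … `≡ 1`"): summing the contour relations
`∮ G^{i+1} = ω ∮ Gⁱ` over `i` gives `(1 - ω) ∮ (G⁰ + G¹ + G²) = 0`, so for `ω ≠ 1` the real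
continuous function `γ = Σ Gⁱ` of any subsequential limit is holomorphic, hence constant, and the
constant is `1` as soon as `G² = 1` at the marked point `R.pt 1` (where `G⁰ = G¹ = 0`); then
`G^{i+1} + G^{i+2} = 1 - Gⁱ = 1` on `Aᵢ`, and the discrete clause follows by compactness
(Arzelà–Ascoli) from the `o(1)`-agreement of the interpolants with the data.

This file (definitions + bookkeeping, no percolation) sets up that reshape:
* `Sig.IsWeakSepData R ω S f` — the fields of `IsSeparatingData` with the boundary clause WEAKENED
  to `fⁱ_δ(z_δ) → 0` on the open arcs, plus the CORNER clause `f²_δ(z_δ) → 1` for some `z_δ → R.pt 1`;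
* `Sig.stub_weakBoundaryUpgrade` — the registered analysis stub of the line:
  `ω ≠ 1 → Sig.IsWeakSepData R ω S f → IsSeparatingData R ω S f` (provable now from the tree's
  `SmirnovSeparatingData` / `SmirnovContinuumLimitProofs` machinery; no percolation);
* `exists_isSeparatingData_of_mesoscopicColourSwitching_weak` — the route's
  `exists_isSeparatingData_of_mesoscopicColourSwitching` with the boundary values of pp. 200–201
  replaced by their weak form + the corner clause (same proof for the other five fields, then the
  upgrade stub), and `exists_separatingData_triBond_of_mesoscopicColourSwitching_weak`, the
  datum-wise hypothesis of `SeparatingDataToCardy` from two weak approximations and the sandwich.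

Provenance in prose `(ref: …)`: these are the line's own obligations/bookkeeping, not Literature facts.
References: B. Bollobás, O. Riordan, *Percolation*, CUP 2006, Ch. 7 pp. 196–203 [BollobasRiordan2006];
S. Smirnov, C. R. Acad. Sci. Paris 333 (2001) [Smirnov2001].
-/

noncomputable section

namespace Summit.CriticalPhenomena.CardyFormulaZ2.Theorems.BondTriangularCardyLine

open Set Filter Topology Metric
open Literature.Probability.Percolation Literature.Probability.RandomPlanarGeometry
open Literature.Probability.RandomPlanarGeometry.MarkedDomain
open Literature.Probability.LatticeModels
open Summit.CriticalPhenomena.CardyFormulaZ2.Theorems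

/-! ### Weak separating data and the upgrade stub -/

/-- **Weak discrete separating data** for the conformal rectangle `R` with root of unity `ω`: the
clauses `mem_Icc`, `dense`, `interior`, `equicontinuous`, `cauchy` of
`Literature.Probability.Percolation.IsSeparatingData` verbatim, the boundary clause WEAKENED to
"for every point `z` of the open arc `Aᵢ` there are `z_δ ∈ S_δ ∩ Ω`, `z_δ → z`, with
`fⁱ_δ(z_δ) → 0`" (no `f^{i+1} + f^{i+2} → 1`), and the CORNER normalisation "there are
`z_δ ∈ S_δ ∩ Ω`, `z_δ → R.pt 1` (the marked point between `A₀` and `A₁`), with `f²_δ(z_δ) → 1`".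
(ref: BollobasRiordan2006, Ch. 7 (9) p. 180, Lemma 13 p. 181, pp. 196–201) -/
def Sig.IsWeakSepData (R : Literature.Probability.RandomPlanarGeometry.ConformalRectangle) (ω : ℂ)
    (S : ℝ → Finset ℂ) (f : ℝ → Fin 3 → ℂ → ℝ) : Prop :=
  (∀ (δ : ℝ) (i : Fin 3), ∀ w ∈ S δ, f δ i w ∈ Icc (0 : ℝ) 1) ∧
  (∃ ε : ℝ → ℝ, Tendsto ε (𝓝[>] 0) (𝓝 0) ∧
    ∀ᶠ δ in 𝓝[>] (0 : ℝ), ∀ z ∈ closure R.carrier, ∃ w ∈ S δ, dist z w ≤ ε δ) ∧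
  (∀ K : Set ℂ, IsCompact K → K ⊆ R.carrier →
    ∀ᶠ δ : ℝ in 𝓝[>] 0, ∀ x : Literature.Probability.LatticeModels.HexVertex,
      (δ : ℂ) * Literature.Probability.LatticeModels.hexCenter x ∈ K →
        (δ : ℂ) * Literature.Probability.LatticeModels.hexCenter x ∈ S δ) ∧
  (∀ β > (0 : ℝ), ∃ η > (0 : ℝ), ∀ᶠ δ in 𝓝[>] (0 : ℝ), ∀ (i : Fin 3),
    ∀ z ∈ S δ, ∀ w ∈ S δ, dist z w < η → f δ i z - f δ i w ≤ β) ∧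
  (∃ e : ℝ → ℝ, Tendsto e (𝓝[>] 0) (𝓝 0) ∧ ∀ K : Set ℂ, IsCompact K → K ⊆ R.carrier →
    ∀ᶠ δ in 𝓝[>] (0 : ℝ), ∀ (i : Fin 3) (x : Literature.Probability.LatticeModels.Site 2) (n : ℕ) (s : ℝ),
      (s = δ ∨ s = -δ) →
      convexHull ℝ {Literature.Probability.LatticeModels.triMeshPoint δ x,
          Literature.Probability.LatticeModels.triMeshPoint δ x + n * s,
          Literature.Probability.LatticeModels.triMeshPoint δ x + n * s *
            Literature.Probability.LatticeModels.triZeta} ⊆ K →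
        ‖Literature.Probability.Percolation.discreteTriangleIntegral (f δ (i + 1))
              (Literature.Probability.LatticeModels.triMeshPoint δ x) s n -
            ω * Literature.Probability.Percolation.discreteTriangleIntegral (f δ i)
              (Literature.Probability.LatticeModels.triMeshPoint δ x) s n‖ ≤ n * δ * e δ) ∧
  (∀ (i : Fin 3), ∀ z ∈ (Literature.Probability.RandomPlanarGeometry.MarkedDomain.forgetLast R).boundary ''
      Ioo ((Literature.Probability.RandomPlanarGeometry.MarkedDomain.forgetLast R).mark i)
        ((Literature.Probability.RandomPlanarGeometry.MarkedDomain.forgetLast R).nextMark i),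
    ∃ zs : ℝ → ℂ, (∀ᶠ δ in 𝓝[>] (0 : ℝ), zs δ ∈ S δ ∧ zs δ ∈ R.carrier) ∧
      Tendsto zs (𝓝[>] 0) (𝓝 z) ∧ Tendsto (fun δ => f δ i (zs δ)) (𝓝[>] 0) (𝓝 0)) ∧
  (∃ zs : ℝ → ℂ, (∀ᶠ δ in 𝓝[>] (0 : ℝ), zs δ ∈ S δ ∧ zs δ ∈ R.carrier) ∧
      Tendsto zs (𝓝[>] 0) (𝓝 (R.pt 1)) ∧ Tendsto (fun δ => f δ 2 (zs δ)) (𝓝[>] 0) (𝓝 1))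

/-- **Signature of the analysis stub `stub_weakBoundaryUpgrade` (reshape v3): weak separating data
are separating data** when `ω ≠ 1`. Why true: the contour clause of every subsequential uniform
limit `G` of the McShane interpolants (`limit_contour_of_separatingData`, which uses only
`mem_Icc`/`dense`/`equicontinuous`/`cauchy`) summed over `i` gives `(1 - ω) ∮ Σ Gⁱ = 0` on lattice
triangles, so `Σ Gⁱ` is holomorphic (lattice Morera, `differentiableOn_of_forall_latticeTriangle`)
and real, hence constant on the Jordan domain; the weak clause gives `Gⁱ = 0` on the closed arc
`Aᵢ`, so at `R.pt 1 ∈ A₀ ∩ A₁` the constant is `G²(R.pt 1) = 1` by the corner clause; thus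
`G^{i+1} + G^{i+2} = 1` on `Aᵢ`, and by Arzelà–Ascoli + `dataFamily_approx` the discrete sums
`f^{i+1}_δ(z_δ) + f^{i+2}_δ(z_δ)` tend to `1` along the weak clause's own `z_δ`. No percolation.
(ref: BollobasRiordan2006, Ch. 7 proof of Claim 24 p. 201; Smirnov2001) -/
def Sig.stub_weakBoundaryUpgrade : Prop :=
  ∀ (R : Literature.Probability.RandomPlanarGeometry.ConformalRectangle) (ω : ℂ) (S : ℝ → Finset ℂ)
    (f : ℝ → Fin 3 → ℂ → ℝ), ω ≠ 1 → Sig.IsWeakSepData R ω S f →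
      Literature.Probability.Percolation.IsSeparatingData R ω S f

/-- `ζ² ≠ 1` (`triOmega = e^{2πi/3}`). [folklore] -/
theorem triOmega_ne_one : triOmega ≠ 1 := by
  intro h
  have him : (triZeta ^ 2).im = (1 : ℂ).im := by rw [← h]; rfl
  have hz : (triZeta ^ 2).im = Real.sqrt 3 / 2 := by
    rw [sq, Complex.mul_im, triZeta_re, triZeta_im]; ring
  rw [hz, Complex.one_im] at him
  have h3 : (0 : ℝ) < Real.sqrt 3 := Real.sqrt_pos.2 (by norm_num)
  linarith

/-! ### Weak separating data from the crux `MesoscopicColourSwitching` -/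

/-- **Weak separating data for critical bond-`𝕋` from `MesoscopicColourSwitching`** — the route's
`exists_isSeparatingData_of_mesoscopicColourSwitching` with the boundary values of pp. 200–201
replaced by their WEAK form (`fⁱ → 0` near the open arc `Aᵢ`) and the corner normalisation
(`f² → 1` near `R.pt 1`): the five other clauses are proved verbatim as there (`(10)` is
`clSepProb_sub_clSepProb`, the discrete Cauchy clause is
`norm_discreteTriangleIntegral_sub_mul_le_signed` fed with the crux, density/interior/
equicontinuity are the geometry of `IsDiscreteApprox` and the p. 198 estimate).
(ref: BollobasRiordan2006, Ch. 7 §7.2.6 pp. 196–201, Lemma 13 pp. 181–182) -/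
theorem exists_isWeakSepData_of_mesoscopicColourSwitching
    (hMCS : Summit.CriticalPhenomena.CardyFormulaZ2.Theses.CardyBondTriangular.MesoscopicColourSwitching)
    {R : ConformalRectangle} {G : ℝ → TriMarkedDomain 4} (hG : IsDiscreteApprox R G)
    (h12 : ∀ K : Set ℂ, IsCompact K → K ⊆ R.carrier → ∃ ε : ℝ → ℝ, Tendsto ε (𝓝[>] 0) (𝓝 0) ∧
      ∀ᶠ δ : ℝ in 𝓝[>] 0, ∀ w : HexVertex, (δ : ℂ) * hexCenter w ∈ K → ∀ i j : Fin 3,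
        (G δ).dropLast.clSepDiffProb ChayesLeiHexPercolation.triBondCritical i w (oppFace w j) ≤ ε δ)
    (h198 : ∀ β > (0 : ℝ), ∃ γ > (0 : ℝ), ∀ᶠ δ : ℝ in 𝓝[>] 0, ∀ (i : Fin 3) (w z : HexVertex),
      w ∈ (G δ).faces → Relation.ReflTransGen (fun x y : HexVertex => hexGraph.Adj x y ∧
        y ∈ (G δ).faces ∧ dist ((δ : ℂ) * hexCenter w) ((δ : ℂ) * hexCenter y) < 2 * γ) w z →
        (G δ).dropLast.clSepProb ChayesLeiHexPercolation.triBondCritical i z -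
          (G δ).dropLast.clSepProb ChayesLeiHexPercolation.triBondCritical i w ≤ β)
    (h200 : ∀ (i : Fin 3), ∀ z ∈ (forgetLast R).boundary ''
        Ioo ((forgetLast R).mark i) ((forgetLast R).nextMark i),
      ∃ zs : ℝ → HexVertex,
        (∀ᶠ δ in 𝓝[>] (0 : ℝ), zs δ ∈ (G δ).faces ∧ (δ : ℂ) * hexCenter (zs δ) ∈ R.carrier) ∧
          Tendsto (fun δ : ℝ => (δ : ℂ) * hexCenter (zs δ)) (𝓝[>] 0) (𝓝 z) ∧
            Tendsto (fun δ => (G δ).dropLast.clSepProb ChayesLeiHexPercolation.triBondCritical i (zs δ))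
              (𝓝[>] 0) (𝓝 0))
    (hcorner : ∃ zs : ℝ → HexVertex,
        (∀ᶠ δ in 𝓝[>] (0 : ℝ), zs δ ∈ (G δ).faces ∧ (δ : ℂ) * hexCenter (zs δ) ∈ R.carrier) ∧
          Tendsto (fun δ : ℝ => (δ : ℂ) * hexCenter (zs δ)) (𝓝[>] 0) (𝓝 (R.pt 1)) ∧
            Tendsto (fun δ => (G δ).dropLast.clSepProb ChayesLeiHexPercolation.triBondCritical 2 (zs δ))
              (𝓝[>] 0) (𝓝 1)) :
    ∃ f : ℝ → Fin 3 → ℂ → ℝ,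
      (∀ δ, δ ≠ 0 → ∀ i w, f δ i ((δ : ℂ) * hexCenter w) =
        (G δ).dropLast.clSepProb ChayesLeiHexPercolation.triBondCritical i w) ∧
        Sig.IsWeakSepData R triOmega (fun δ => ((G δ).faces).image fun w => (δ : ℂ) * hexCenter w) f := by
  set M : ChayesLeiHexPercolation := ChayesLeiHexPercolation.triBondCritical with hM
  set F : ℝ → Fin 3 → HexVertex → ℝ := fun δ i w => (G δ).dropLast.clSepProb M i w with hFdef
  set g : ℝ → Fin 3 → HexVertex → HexVertex → ℝ := fun δ i w z => (G δ).dropLast.clSepDiffProb M i w z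
    with hgdef
  have hF : ∀ δ i w, F δ i w ∈ Icc (0 : ℝ) 1 := fun δ i w =>
    ⟨MeasureTheory.measureReal_nonneg, MeasureTheory.measureReal_le_one⟩
  have h10 : ∀ δ (i : Fin 3) (w : HexVertex) (j : Fin 3),
      F δ i (oppFace w j) - F δ i w = g δ i w (oppFace w j) - g δ i (oppFace w j) w :=
    fun δ i w j => (G δ).dropLast.clSepProb_sub_clSepProb M i w (oppFace w j)
  obtain ⟨f, hf, hf01⟩ := exists_faceExtension F hF
  refine ⟨f, hf, ?_⟩
  -- the rate of the crux and the exhaustion `K_m` of `Ω` with the rates of (12)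
  obtain ⟨e, he, hMCS'⟩ := hMCS R G hG
  obtain ⟨Km, hKm⟩ : ∃ Km : ℕ → Set ℂ, ∀ m, Km m = {z : ℂ | 1 / ((m : ℝ) + 1) ≤ infDist z R.carrierᶜ} :=
    ⟨_, fun _ => rfl⟩
  have hKc : ∀ m, IsCompact (Km m) ∧ Km m ⊆ R.carrier := fun m => by
    rw [hKm]; exact isCompact_deep R (by positivity)
  choose ε hε hεK using fun m => h12 (Km m) (hKc m).1 (hKc m).2
  obtain ⟨em, hem⟩ : ∃ em : ℕ → ℝ → ℝ, ∀ m δ, em m δ = 6 * |ε m δ| + ‖2 * triZeta - 1‖ * |e δ| :=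
    ⟨_, fun _ _ => rfl⟩
  have hem0 : ∀ m, Tendsto (em m) (𝓝[>] 0) (𝓝 0) := by
    intro m
    have h1 := ((hε m).abs.const_mul 6).add (he.abs.const_mul ‖2 * triZeta - 1‖)
    simp only [abs_zero, mul_zero, add_zero] at h1
    exact h1.congr fun δ => (hem m δ).symm
  obtain ⟨E, hE, hEe⟩ := exists_rate_dominating em hem0
  have hpos : ∀ᶠ δ in 𝓝[>] (0 : ℝ), δ ≠ 0 :=
    (eventually_mem_nhdsWithin).mono fun δ hδ => ne_of_gt hδ
  refine ⟨fun δ i w _ => hf01 δ i w, ?_, ?_, ?_, ?_, ?_, ?_⟩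
  · -- dense
    obtain ⟨ε', hε', h⟩ := hG.dense
    refine ⟨ε', hε', h.mono fun δ hδ z hz => ?_⟩
    obtain ⟨w, hw, hd⟩ := hδ z hz
    exact ⟨_, Finset.mem_image_of_mem _ hw, hd⟩
  · -- interior
    intro K hK hKΩ
    obtain ⟨κ, hκ, hK'⟩ := hK.exists_cthickening_subset_open R.isOpen hKΩ
    have hfill := hG.fill (cthickening κ K) hK.cthickening hK'
    have hsmall : ∀ᶠ δ in 𝓝[>] (0 : ℝ), δ ∈ Ioc 0 κ := Ioc_mem_nhdsGT hκ
    filter_upwards [hfill, hsmall] with δ hfill hδ x hxK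
    refine Finset.mem_image_of_mem _ (((G δ).mem_faces).2 fun v hv => hfill v ?_)
    refine mem_cthickening_of_dist_le _ _ _ _ hxK ?_
    exact (dist_triMeshPoint_hexCenter_le hv δ).trans (by rw [abs_of_pos hδ.1]; exact hδ.2)
  · -- equicontinuous
    intro β hβ
    obtain ⟨γ, hγ, h198'⟩ := h198 β hβ
    obtain ⟨θ, hθ, hloc⟩ := hG.local_conn γ hγ
    refine ⟨θ, hθ, ?_⟩
    filter_upwards [hloc, h198', self_mem_nhdsWithin] with δ hloc h198' hδ i z hz w hw hzw
    obtain ⟨Z, hZ, rfl⟩ := Finset.mem_image.1 hz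
    obtain ⟨W, hW, rfl⟩ := Finset.mem_image.1 hw
    have hδ0 : δ ≠ 0 := ne_of_gt hδ
    rw [hf δ hδ0, hf δ hδ0]
    exact h198' i W Z hW (hloc W hW Z hZ (by rw [dist_comm]; exact hzw))
  · -- cauchy
    classical
    refine ⟨E, hE, fun K hK hKΩ => ?_⟩
    obtain ⟨m, hm⟩ := exists_subset_deep R hK hKΩ
    rw [← hKm] at hm
    filter_upwards [hεK m, hMCS' (Km m) (hKc m).1 (hKc m).2, hG.fill (Km m) (hKc m).1 (hKc m).2,
      hEe m, self_mem_nhdsWithin] with δ h12' hb hfill hEδ hδ i x₀ n s hs hT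
    have hδpos : 0 < δ := hδ
    have hδ0 : δ ≠ 0 := ne_of_gt hδpos
    have hTK := hT.trans hm
    -- the faces with vertices in the solid triangle, as booked by the crux
    obtain ⟨C, hC, hbC⟩ : ∃ C : Finset HexVertex,
        (∀ w : HexVertex, w ∈ C ↔ ∀ v ∈ hexFaceVertices w, triMeshPoint δ v ∈
          convexHull ℝ ({triMeshPoint δ x₀, triMeshPoint δ x₀ + n * s,
            triMeshPoint δ x₀ + n * s * triZeta} : Set ℂ)) ∧
        ‖∑ w ∈ C, ∑ j : Fin 3, ((δ : ℂ) * hexCenter (oppFace w j) - (δ : ℂ) * hexCenter w) *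
          ((g δ (i + 1) w (oppFace w (j + 1)) - g δ i w (oppFace w j) : ℝ) : ℂ)‖ ≤ n * δ * e δ := by
      refine ⟨_, fun w => ?_, hb i x₀ n s hs hTK⟩
      rw [Finset.mem_filter]
      constructor
      · exact fun h => h.2
      · intro h
        exact ⟨((G δ).dropLast.mem_faces).2 fun v hv => hfill v (hTK (h v hv)), h⟩
    have key := norm_discreteTriangleIntegral_sub_mul_le_signed hδpos x₀ n hs (f δ) (g δ)
      (ε := |ε m δ|) hTK C hC
      (fun w _ j _ i => by rw [hf δ hδ0, hf δ hδ0]; exact h10 δ i w j)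
      (fun w hw i j => by
        have h0 : 0 ≤ g δ i w (oppFace w j) := MeasureTheory.measureReal_nonneg
        rw [abs_of_nonneg h0]
        exact (h12' w hw i j).trans (le_abs_self _)) i
    have hn0 : (0 : ℝ) ≤ n := n.cast_nonneg
    have hrate : 6 * n * δ * |ε m δ| + ‖2 * triZeta - 1‖ *
        ‖∑ w ∈ C, ∑ j : Fin 3, ((δ : ℂ) * hexCenter (oppFace w j) - (δ : ℂ) * hexCenter w) *
          ((g δ (i + 1) w (oppFace w (j + 1)) - g δ i w (oppFace w j) : ℝ) : ℂ)‖ ≤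
        n * δ * em m δ := by
      rw [hem]
      have h1 : (n : ℝ) * δ * e δ ≤ n * δ * |e δ| :=
        mul_le_mul_of_nonneg_left (le_abs_self _) (mul_nonneg hn0 hδpos.le)
      have h2 := mul_le_mul_of_nonneg_left (hbC.trans h1) (norm_nonneg (2 * triZeta - 1))
      nlinarith [h2, abs_nonneg (ε m δ)]
    calc _ ≤ _ := key
      _ ≤ n * δ * em m δ := hrate
      _ ≤ n * δ * E δ := mul_le_mul_of_nonneg_left hEδ (mul_nonneg hn0 hδpos.le)
  · -- weak boundary values on the open arcs
    intro i z hz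
    obtain ⟨zs, hzs, hzt, hf0⟩ := h200 i z hz
    refine ⟨fun δ => (δ : ℂ) * hexCenter (zs δ), hzs.mono fun δ hδ =>
      ⟨Finset.mem_image_of_mem _ hδ.1, hδ.2⟩, hzt, ?_⟩
    exact hf0.congr' (hpos.mono fun δ hδ => (hf δ hδ i (zs δ)).symm)
  · -- the corner normalisation at `R.pt 1`
    obtain ⟨zs, hzs, hzt, hf1⟩ := hcorner
    refine ⟨fun δ => (δ : ℂ) * hexCenter (zs δ), hzs.mono fun δ hδ =>
      ⟨Finset.mem_image_of_mem _ hδ.1, hδ.2⟩, hzt, ?_⟩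
    exact hf1.congr' (hpos.mono fun δ hδ => (hf δ hδ 2 (zs δ)).symm)

/-- **Separating data for critical bond-`𝕋` from `MesoscopicColourSwitching`, the weak boundary
values and the analysis stub `stub_weakBoundaryUpgrade`.** (ref: BollobasRiordan2006, Ch. 7 §7.2.6 pp. 196–201) -/
theorem exists_isSeparatingData_of_mesoscopicColourSwitching_weak
    (hup : Sig.stub_weakBoundaryUpgrade)
    (hMCS : Summit.CriticalPhenomena.CardyFormulaZ2.Theses.CardyBondTriangular.MesoscopicColourSwitching)
    {R : ConformalRectangle} {G : ℝ → TriMarkedDomain 4} (hG : IsDiscreteApprox R G)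
    (h12 : ∀ K : Set ℂ, IsCompact K → K ⊆ R.carrier → ∃ ε : ℝ → ℝ, Tendsto ε (𝓝[>] 0) (𝓝 0) ∧
      ∀ᶠ δ : ℝ in 𝓝[>] 0, ∀ w : HexVertex, (δ : ℂ) * hexCenter w ∈ K → ∀ i j : Fin 3,
        (G δ).dropLast.clSepDiffProb ChayesLeiHexPercolation.triBondCritical i w (oppFace w j) ≤ ε δ)
    (h198 : ∀ β > (0 : ℝ), ∃ γ > (0 : ℝ), ∀ᶠ δ : ℝ in 𝓝[>] 0, ∀ (i : Fin 3) (w z : HexVertex),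
      w ∈ (G δ).faces → Relation.ReflTransGen (fun x y : HexVertex => hexGraph.Adj x y ∧
        y ∈ (G δ).faces ∧ dist ((δ : ℂ) * hexCenter w) ((δ : ℂ) * hexCenter y) < 2 * γ) w z →
        (G δ).dropLast.clSepProb ChayesLeiHexPercolation.triBondCritical i z -
          (G δ).dropLast.clSepProb ChayesLeiHexPercolation.triBondCritical i w ≤ β)
    (h200 : ∀ (i : Fin 3), ∀ z ∈ (forgetLast R).boundary ''
        Ioo ((forgetLast R).mark i) ((forgetLast R).nextMark i),
      ∃ zs : ℝ → HexVertex,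
        (∀ᶠ δ in 𝓝[>] (0 : ℝ), zs δ ∈ (G δ).faces ∧ (δ : ℂ) * hexCenter (zs δ) ∈ R.carrier) ∧
          Tendsto (fun δ : ℝ => (δ : ℂ) * hexCenter (zs δ)) (𝓝[>] 0) (𝓝 z) ∧
            Tendsto (fun δ => (G δ).dropLast.clSepProb ChayesLeiHexPercolation.triBondCritical i (zs δ))
              (𝓝[>] 0) (𝓝 0))
    (hcorner : ∃ zs : ℝ → HexVertex,
        (∀ᶠ δ in 𝓝[>] (0 : ℝ), zs δ ∈ (G δ).faces ∧ (δ : ℂ) * hexCenter (zs δ) ∈ R.carrier) ∧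
          Tendsto (fun δ : ℝ => (δ : ℂ) * hexCenter (zs δ)) (𝓝[>] 0) (𝓝 (R.pt 1)) ∧
            Tendsto (fun δ => (G δ).dropLast.clSepProb ChayesLeiHexPercolation.triBondCritical 2 (zs δ))
              (𝓝[>] 0) (𝓝 1)) :
    ∃ f : ℝ → Fin 3 → ℂ → ℝ,
      (∀ δ, δ ≠ 0 → ∀ i w, f δ i ((δ : ℂ) * hexCenter w) =
        (G δ).dropLast.clSepProb ChayesLeiHexPercolation.triBondCritical i w) ∧
        IsSeparatingData R triOmega (fun δ => ((G δ).faces).image fun w => (δ : ℂ) * hexCenter w) f := by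
  obtain ⟨f, hf, hweak⟩ :=
    exists_isWeakSepData_of_mesoscopicColourSwitching hMCS hG h12 h198 h200 hcorner
  exact ⟨f, hf, hup R triOmega _ f triOmega_ne_one hweak⟩

/-- **The switching reduction for one anticlockwise Carleson datum with WEAK boundary values**
(reshape v3): from the crux `MesoscopicColourSwitching`, the analysis stub
`stub_weakBoundaryUpgrade`, an inner and an outer discrete approximation each satisfying (12), the
p. 198 estimate, the weak boundary values `fⁱ → 0` on the open arcs and the corner normalisation
`f² → 1` at `R.pt 1`, and the sandwich of a crossing-probability function `Q` between the values
`f¹` at triangles `z∓_δ → d' = R.pt 3`, one has literally the datum-wise hypothesis of the route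
item `SeparatingDataToCardy` with `ω = ζ²` (ref: BollobasRiordan2006, Ch. 7 proof of Thm. 2 pp. 202–203). -/
theorem exists_separatingData_triBond_of_mesoscopicColourSwitching_weak
    (hup : Sig.stub_weakBoundaryUpgrade)
    (hMCS : Summit.CriticalPhenomena.CardyFormulaZ2.Theses.CardyBondTriangular.MesoscopicColourSwitching)
    {R : ConformalRectangle} {Gm Gp : ℝ → TriMarkedDomain 4}
    (hGm : IsDiscreteApprox R Gm) (hGp : IsDiscreteApprox R Gp)
    (h12m : ∀ K : Set ℂ, IsCompact K → K ⊆ R.carrier → ∃ ε : ℝ → ℝ, Tendsto ε (𝓝[>] 0) (𝓝 0) ∧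
      ∀ᶠ δ : ℝ in 𝓝[>] 0, ∀ w : HexVertex, (δ : ℂ) * hexCenter w ∈ K → ∀ i j : Fin 3,
        (Gm δ).dropLast.clSepDiffProb ChayesLeiHexPercolation.triBondCritical i w (oppFace w j) ≤ ε δ)
    (h198m : ∀ β > (0 : ℝ), ∃ γ > (0 : ℝ), ∀ᶠ δ : ℝ in 𝓝[>] 0, ∀ (i : Fin 3) (w z : HexVertex),
      w ∈ (Gm δ).faces → Relation.ReflTransGen (fun x y : HexVertex => hexGraph.Adj x y ∧
        y ∈ (Gm δ).faces ∧ dist ((δ : ℂ) * hexCenter w) ((δ : ℂ) * hexCenter y) < 2 * γ) w z →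
        (Gm δ).dropLast.clSepProb ChayesLeiHexPercolation.triBondCritical i z -
          (Gm δ).dropLast.clSepProb ChayesLeiHexPercolation.triBondCritical i w ≤ β)
    (h200m : ∀ (i : Fin 3), ∀ z ∈ (forgetLast R).boundary ''
        Ioo ((forgetLast R).mark i) ((forgetLast R).nextMark i),
      ∃ zs : ℝ → HexVertex,
        (∀ᶠ δ in 𝓝[>] (0 : ℝ), zs δ ∈ (Gm δ).faces ∧ (δ : ℂ) * hexCenter (zs δ) ∈ R.carrier) ∧
          Tendsto (fun δ : ℝ => (δ : ℂ) * hexCenter (zs δ)) (𝓝[>] 0) (𝓝 z) ∧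
            Tendsto (fun δ => (Gm δ).dropLast.clSepProb ChayesLeiHexPercolation.triBondCritical i (zs δ))
              (𝓝[>] 0) (𝓝 0))
    (hcm : ∃ zs : ℝ → HexVertex,
        (∀ᶠ δ in 𝓝[>] (0 : ℝ), zs δ ∈ (Gm δ).faces ∧ (δ : ℂ) * hexCenter (zs δ) ∈ R.carrier) ∧
          Tendsto (fun δ : ℝ => (δ : ℂ) * hexCenter (zs δ)) (𝓝[>] 0) (𝓝 (R.pt 1)) ∧
            Tendsto (fun δ => (Gm δ).dropLast.clSepProb ChayesLeiHexPercolation.triBondCritical 2 (zs δ))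
              (𝓝[>] 0) (𝓝 1))
    (h12p : ∀ K : Set ℂ, IsCompact K → K ⊆ R.carrier → ∃ ε : ℝ → ℝ, Tendsto ε (𝓝[>] 0) (𝓝 0) ∧
      ∀ᶠ δ : ℝ in 𝓝[>] 0, ∀ w : HexVertex, (δ : ℂ) * hexCenter w ∈ K → ∀ i j : Fin 3,
        (Gp δ).dropLast.clSepDiffProb ChayesLeiHexPercolation.triBondCritical i w (oppFace w j) ≤ ε δ)
    (h198p : ∀ β > (0 : ℝ), ∃ γ > (0 : ℝ), ∀ᶠ δ : ℝ in 𝓝[>] 0, ∀ (i : Fin 3) (w z : HexVertex),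
      w ∈ (Gp δ).faces → Relation.ReflTransGen (fun x y : HexVertex => hexGraph.Adj x y ∧
        y ∈ (Gp δ).faces ∧ dist ((δ : ℂ) * hexCenter w) ((δ : ℂ) * hexCenter y) < 2 * γ) w z →
        (Gp δ).dropLast.clSepProb ChayesLeiHexPercolation.triBondCritical i z -
          (Gp δ).dropLast.clSepProb ChayesLeiHexPercolation.triBondCritical i w ≤ β)
    (h200p : ∀ (i : Fin 3), ∀ z ∈ (forgetLast R).boundary ''
        Ioo ((forgetLast R).mark i) ((forgetLast R).nextMark i),
      ∃ zs : ℝ → HexVertex,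
        (∀ᶠ δ in 𝓝[>] (0 : ℝ), zs δ ∈ (Gp δ).faces ∧ (δ : ℂ) * hexCenter (zs δ) ∈ R.carrier) ∧
          Tendsto (fun δ : ℝ => (δ : ℂ) * hexCenter (zs δ)) (𝓝[>] 0) (𝓝 z) ∧
            Tendsto (fun δ => (Gp δ).dropLast.clSepProb ChayesLeiHexPercolation.triBondCritical i (zs δ))
              (𝓝[>] 0) (𝓝 0))
    (hcp : ∃ zs : ℝ → HexVertex,
        (∀ᶠ δ in 𝓝[>] (0 : ℝ), zs δ ∈ (Gp δ).faces ∧ (δ : ℂ) * hexCenter (zs δ) ∈ R.carrier) ∧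
          Tendsto (fun δ : ℝ => (δ : ℂ) * hexCenter (zs δ)) (𝓝[>] 0) (𝓝 (R.pt 1)) ∧
            Tendsto (fun δ => (Gp δ).dropLast.clSepProb ChayesLeiHexPercolation.triBondCritical 2 (zs δ))
              (𝓝[>] 0) (𝓝 1))
    {zm zp : ℝ → HexVertex} {e Q : ℝ → ℝ}
    (hzm : ∀ᶠ δ : ℝ in 𝓝[>] 0, zm δ ∈ (Gm δ).faces ∧ (δ : ℂ) * hexCenter (zm δ) ∈ R.carrier)
    (hzp : ∀ᶠ δ : ℝ in 𝓝[>] 0, zp δ ∈ (Gp δ).faces ∧ (δ : ℂ) * hexCenter (zp δ) ∈ R.carrier)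
    (hztm : Tendsto (fun δ : ℝ => (δ : ℂ) * hexCenter (zm δ)) (𝓝[>] 0) (𝓝 (R.pt 3)))
    (hztp : Tendsto (fun δ : ℝ => (δ : ℂ) * hexCenter (zp δ)) (𝓝[>] 0) (𝓝 (R.pt 3)))
    (he : Tendsto e (𝓝[>] 0) (𝓝 0))
    (hsand : ∀ᶠ δ : ℝ in 𝓝[>] 0,
      (Gm δ).dropLast.clSepProb ChayesLeiHexPercolation.triBondCritical 1 (zm δ) - e δ ≤ Q δ ∧
        Q δ ≤ (Gp δ).dropLast.clSepProb ChayesLeiHexPercolation.triBondCritical 1 (zp δ) + e δ) :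
    ∃ (Sm Sp : ℝ → Finset ℂ) (fm fp : ℝ → Fin 3 → ℂ → ℝ),
      IsSeparatingData R triOmega Sm fm ∧ IsSeparatingData R triOmega Sp fp ∧
        ∃ (zm zp : ℝ → ℂ) (e : ℝ → ℝ),
          (∀ᶠ δ in 𝓝[>] (0 : ℝ),
              zm δ ∈ Sm δ ∧ zm δ ∈ R.carrier ∧ zp δ ∈ Sp δ ∧ zp δ ∈ R.carrier) ∧
            Tendsto zm (𝓝[>] 0) (𝓝 (R.pt 3)) ∧ Tendsto zp (𝓝[>] 0) (𝓝 (R.pt 3)) ∧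
              Tendsto e (𝓝[>] 0) (𝓝 0) ∧
                ∀ᶠ δ in 𝓝[>] (0 : ℝ), fm δ 1 (zm δ) - e δ ≤ Q δ ∧ Q δ ≤ fp δ 1 (zp δ) + e δ :=
  exists_separatingData_sandwich
    (exists_isSeparatingData_of_mesoscopicColourSwitching_weak hup hMCS hGm h12m h198m h200m hcm)
    (exists_isSeparatingData_of_mesoscopicColourSwitching_weak hup hMCS hGp h12p h198p h200p hcp)
    hzm hzp hztm hztp he hsand

end Summit.CriticalPhenomena.CardyFormulaZ2.Theorems.BondTriangularCardyLine

end
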